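import Summits.QuantumFields.YangMills.Theorems.BalabanUVNodesN22AtRecordOfTermStepLipschitz

/-!
# BalabanUVNodes ∕ node N22 = NE9 — ROAD 1 AT THE GENERATED RUN TOWERS OF RECORD: K3's `h9`, the kernel-face socket and the pin face from the FIRST-ORDER ONE-STEP-MAP SCHEMA (G-T1)
# on node00-def-W1's generator towers `Gn K` + (Adm-run), read at `truncRun K (toClusterTower (Gn K))`, + term holomorphy through the readings ∕ tails ∕ W1-20's law ∕ (1.21), under
# the END OF RECORD's clause `ω₁ + c ≤ ℓ.ω` — «J55 AT THE GENERATED RUN TOWERS»; NO node-N18 letter, NO second order, NO output bound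

Cell `pub-ymgap`, HUMAN RULING D-0062 (Track A), R134 seat `pub-ymgap-dag-n22-c` (strategy s1), generation 17, module J56.  THEOREMS ONLY (no `def`, no `sorry`, standard axioms);
`--kind proof --supports stmt-QuantumFields-27366 --as helper` (K3⁸ `SpineGivenEndpointR13SepCoPHV`, skeleton v6 — §2b N22 face `h9` verbatim), COUNT-NEUTRAL.  Imports module J55
`…N22AtRecordOfTermStepLipschitz` (`TermRecursion.coordLetter_box_truncRun_toClusterTower_of_gen`, `table_le_moduli_of_rows`; through it J53, J51, dag-n22-w5's J34∕J36-at-record and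
dag-n22-w3's faces).  Nothing re-declared; §1–§3 are ONE application each, §0 two rewrites ∕ one application.

WHY.  Module J55 keys ROAD 1 (first order, clause N2) to the record for abstract towers `S K`; module J54 keys ROAD 2 to def-W1's GENERATOR.  THIS FILE is the remaining corner: ROAD 1 on
the generator — the single property (G-T1) «the one-step map `(g_k, (E^{(j)})_{j≤k}) ↦ E^{(k+1)}(X; ·)` is Lipschitz in the last coupling (constant `lam K k ≤ ℓ₁`) and in the older-term
family through a linear channel `a K k j ≤ c·ω₁^{k−j}` on an admissibility domain» ([I] (2.12)–(2.13) p. 268 and §3 p. 270, pub-balaban's reading; GAPS G-t4-U3-1) + (Adm-run) + the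
END OF RECORD's SMALL-GROWTH clause `ω₁ + c ≤ ℓ.ω` ⟹ K3's `h9`, with NO input from node N18.  It is the producer-facing statement of «N22 on ROAD 1»: ONE Lipschitz property of ONE map
per step, whose linear channel CONTRACTS.
* §0 ★ `TermRecursion.admRun_ball_of_termBound` — (Adm-run) for the (1.18)-BALL domain («older-term families bounded by `E₀e^{−κd}` on the tables») from the output bound of the
  generated terms along the window (def-W1's `TermBound118` shape; [I]'s inductive hypothesis) — the intended `Adm` of J53∕J54∕J56, two rewrites; ★ `admRun_of_recAdmissible` —
  (Adm-run) from def-W1's `RecAdmissible G D Adm'` BY NAME (admissible classes as sets, complex histories in `D ⊇ ]0, γ]`).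
* §1 ★★★ `ne9_EA_objectsOfRecord₁₃_of_genStepLipschitz` — per torus (G-T1) + (Adm-run); term holomorphy through the complexified readings of record, chart ∕ space clauses, tails AT THE
  RUN TOWERS; law `Localizes17OfRecord₁₃ F N θ (fun K => truncRun K (toClusterTower (Gn K))) emb`; (1.21); rows **`ω₁ + c ≤ ℓ.ω`**, `ℓ.κ ≤ δ₁`, `(16B₃²∕r²)e^{12Mδ₁}K₀K₁·ℓ₁ ≤ ℓ.C₉·ℓ.ω`
  ⟹ **`NE9 ((objectsOfRecord₁₃ F N θ ℓ).EA 0) (Window θ.γ) ℓ.κ ℓ.moduli`** — J55's `coordLetter_box_truncRun_toClusterTower_of_gen` per torus (rate lowered `κ_E → κ`) into dag-n22-w5's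
  `ne9_EA_objectsOfRecord₁₃_of_outputCoordLetters`.
* §2 ★★★ `n22At_u3OfRecord₁₃_of_genStepLipschitz` (kernel-face socket, dag-n27-c's `h22` row); §3 ★★★ `n22At_rateCarriers_of_kernels_pin_of_genStepLipschitz` (pin face).
* §4 ★ `exists_letterBlock_rows_road1` — ROAD 1's rows (J55 §2 ∕ §1 here) are jointly satisfiable with `ℓ.Signs` iff `ω₁ + c < 1` (A5 rider, J48 §5's analogue).  The schemas are met by every generator ignoring `(t, old)` (A5: content = the composition's shape, conditional).

HONEST FRAMING (binding).  Count-neutral COMPOSITION; (G-T1) ∕ (Adm-run) are UNPRINTED hypothesis SHAPES on def-W1's generator (GAPS G-t4-U3-1; [I] prints (0.23) p. 256, (2.12)–(2.13)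
p. 268, p. 263, p. 298 without constants — NOTHING quantitative in the older couplings; a producer is node N10 ∕ NODE A on def-T's generator of record); the clause `ω₁ + c ≤ ℓ.ω` is the
END OF RECORD's N2 (NOT PRINTED); nothing of the record is constructed or claimed to meet the displayed inputs; `𝔸 : Type`.  N22 is NOT discharged (typed 28∕28 · discharged 5∕27
UNCHANGED); K3⁸ OPEN and NOT claimed (no stub of 27366 touched); NE9 is NOT IN PRINT for d = 4; no count claim; one finite 𝕋⁴ programme at fixed ε — R4 closes the CONDITIONAL rung
`BalabanLadder.UV` only; NOTHING about the continuum limit, ℝ⁴, infinite volume, OS axioms, a mass gap or the Clay problem is proved or claimed.  References (TYPES only, no cite tags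
on the Summit side): [I] = Bałaban, CMP 109 (1987) Thm 1 p. 259, (0.23)–(0.24) pp. 256–257, (1.7) p. 261, §1 p. 263, (1.20)–(1.22) p. 264, §2 p. 266, (2.12)–(2.13) p. 268, §3
p. 270, p. 282, (4.35)–(4.37) pp. 290–291, (5.10) p. 293, §5 p. 298; [II] = CMP 116 (1988) (1.41) p. 11, (2.13)–(2.14) pp. 14–15.
-/

noncomputable section

open Filter Topology Set Metric
open scoped BigOperators

/-! ## §0 The (1.18)-ball admissibility domain: (Adm-run) from the output bound of the generated terms -/

namespace YMDAG.N22.TermRecursion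

open Literature.MathematicalPhysics.QuantumFieldTheory.Balaban1983to89
open Literature.MathematicalPhysics.QuantumFieldTheory.Balaban1983to89.T4OutputRate (Window)
open Literature.MathematicalPhysics.QuantumFieldTheory.Balaban1983to89.Node00.Sect2 (domSys CPair)
open Literature.MathematicalPhysics.QuantumFieldTheory.Balaban1983to89.Node00.W1

/-- ★ **(Adm-run) FOR THE (1.18)-BALL.**  With the admissibility domain «older-term families bounded by `E₀·e^{−κ d_j(Y)}` on the space tables of the levels `j = 1, …, k`» ([I] (1.18)
p. 263 ∕ [II] (2.41) p. 21 as a DOMAIN for the one-step map — the natural `Adm` of modules J53∕J54∕J56), the generated older-term families of every window history are admissible as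
soon as the generated tower's terms obey that output bound along the window (def-W1's `TermBound118` shape at the levels `≥ 1`; [I]'s inductive hypothesis) —
`olderOf_apply` + `termC_toClusterTower`. [folklore] -/
theorem admRun_ball_of_termBound {P : Params} {𝔸 : Type} {M : ℕ} (G : GenTower P 𝔸 M) (sp : (k : ℕ) → (domSys P M (k + 1)).Dom → Set (CPair P 𝔸))
    {γ κ E₀ : ℝ}
    (h118 : ∀ g ∈ Window γ, ∀ (k : ℕ) (X : (domSys P M (k + 1)).Dom), ∀ φ ∈ sp k X,
      ‖termC (toClusterTower G) (k + 1) X g φ‖ ≤ E₀ * Real.exp (-(κ * (domSys P M (k + 1)).dj X))) :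
    ∀ g ∈ Window γ, ∀ k, (fun (k : ℕ) (old : OlderTerms P 𝔸 M k) =>
      ∀ (k' : ℕ) (hk' : k' < k) (Y : (domSys P M (k' + 1)).Dom), ∀ φ ∈ sp k' Y,
        ‖old ⟨k' + 1, Nat.succ_lt_succ hk'⟩ Y φ‖ ≤ E₀ * Real.exp (-(κ * (domSys P M (k' + 1)).dj Y))) k (olderOf (recTerm G fun n => ((g n : ℝ) : ℂ)) k) := by
  intro g hg k k' hk' Y φ hφ
  rw [olderOf_apply, ← termC_toClusterTower]
  exact h118 g hg k' Y φ hφ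

/-- ★ **(Adm-run) FROM node00-def-W1's `RecAdmissible` BY NAME.**  def-W1's admissibility bookkeeping `RecAdmissible G D Adm'` (complex histories with values in `D`, admissible
CLASSES `Adm' k : Set (OlderTerms P 𝔸 M k)` — [I] p. 263's inductive assumptions as a schema) gives the (Adm-run) hypothesis of modules J53∕J54∕J56 for the predicate
`fun k old => old ∈ Adm' k`, as soon as `D` contains the real window `]0, γ]`. [folklore] -/
theorem admRun_of_recAdmissible {P : Params} {𝔸 : Type} {M : ℕ} (G : GenTower P 𝔸 M) {D : Set ℂ} {Adm' : (k : ℕ) → Set (OlderTerms P 𝔸 M k)} {γ : ℝ}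
    (hAdm : RecAdmissible G D Adm') (hD : ∀ t ∈ Ioc (0 : ℝ) γ, (t : ℂ) ∈ D) :
    ∀ g ∈ Window γ, ∀ k, (fun (k : ℕ) (old : OlderTerms P 𝔸 M k) => old ∈ Adm' k) k (olderOf (recTerm G fun n => ((g n : ℝ) : ℂ)) k) :=
  fun _ hg k => hAdm _ (fun n => hD _ (hg n)) k

end YMDAG.N22.TermRecursion

namespace YMDAG.N22.KernelFading

open Literature.MathematicalPhysics.QuantumFieldTheory.Balaban1983to89
open Literature.MathematicalPhysics.QuantumFieldTheory.Balaban1983to89.T4Continuum (T4Family ULoop)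
open Literature.MathematicalPhysics.QuantumFieldTheory.Balaban1983to89.T4OutputRate (Window NE9)
open Literature.MathematicalPhysics.QuantumFieldTheory.Balaban1983to89.TreeLengthTorus (TPt)
open Literature.MathematicalPhysics.QuantumFieldTheory.Balaban1983to89.B12TreeDecay (K₀ kappa₀)
open Literature.MathematicalPhysics.QuantumFieldTheory.Balaban1983to89.B12Decay510 (delta1)
open Literature.MathematicalPhysics.QuantumFieldTheory.Balaban1983to89.B12Decay510Window (K₁)
open Literature.MathematicalPhysics.QuantumFieldTheory.Balaban1983to89.B12Decay510Torus (distCT nearT)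
open Literature.MathematicalPhysics.QuantumFieldTheory.Balaban1983to89.Node00 (Stage13Params Stage13HParams U3Letters₁₁ MatA)
open Literature.MathematicalPhysics.QuantumFieldTheory.Balaban1983to89.Node00.Sect2 (domSys domCount CPair)
open Literature.MathematicalPhysics.QuantumFieldTheory.Balaban1983to89.Node00.W1
open Literature.MathematicalPhysics.QuantumFieldTheory.Balaban1983to89.Node00.LocalizedSum17 (ReadingMaps Localizes17OfRecord₁₃)
open Literature.MathematicalPhysics.QuantumFieldTheory.Balaban1983to89.Node00.U3OfKernels (histPrefix objectsOfRecord₁₃)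
open Literature.MathematicalPhysics.QuantumFieldTheory.Balaban1983to89.Node00.U3KernelLetters (PolLimitsExistOfRecord₁₃)
open YMDAG.UVSplit (N22At u3OfRecord₁₃ RateReading₁₃CoPH rateCarriersOfRecord₁₃CoPH)
open YMDAG.N22.AtKernels (n22At_rateCarriers_of_kernels_pin_of_ne9 n22At_u3OfRecord₁₃_objectsOfRecord₁₃_iff)
open YMDAG.N22.AtRecordOfPrintedSlots (ne9_EA_objectsOfRecord₁₃_of_outputCoordLetters)
open YMDAG.N22.TermRecursion (coordLetter_box_truncRun_toClusterTower_of_gen table_le_moduli_of_rows)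

open scoped Matrix.Norms.L2Operator

variable (F : T4Family) (N : ℕ) [NeZero N] {𝔸 : Type} {M : ℕ}

/-! ## §1 ★★★ K3's `h9` on ROAD 1 from the generator schema (G-T1) at the run towers of record -/

open Classical Finset in
/-- ★★★ **K3's `h9` ON ROAD 1 FROM THE ONE-STEP MAP's FIRST-ORDER LIPSCHITZ SCHEMA (G-T1) ON node00-def-W1's GENERATOR TOWERS + (Adm-run), READ AT THE RUN TOWERS OF RECORD, UNDER
`ω₁ + c ≤ ℓ.ω` — NO NODE-N18 LETTER, NO SECOND ORDER, NO OUTPUT BOUND.**  At a Stage-13 tuple `θ` (`0 < θ.γ`) with a letter block `ℓ` (`ℓ.Signs`): generator towers `Gn K` whose run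
towers `truncRun K (toClusterTower (Gn K))` meet W1-20's law through `emb`, with (1.21); per torus (G-T1) on the admissibility domains `Adm K k` (`lam K k ≤ ℓ₁`, `a K k j ≤ c·ω₁^{k−j}`,
rate `κ_E ≥ κ`) and (Adm-run); term holomorphy `hEhol` through the complexified readings at the run towers, chart `hΦemb`, space clause `hΦsp`, site weights and tails, `2κ₀(64,8) ≤ κ`; the
ROWS **`ω₁ + c ≤ ℓ.ω`**, `ℓ.κ ≤ δ₁`, `(16B₃²∕r²)e^{12Mδ₁}K₀K₁·ℓ₁ ≤ ℓ.C₉·ℓ.ω` ⟹ **`NE9 ((objectsOfRecord₁₃ F N θ ℓ).EA 0) (Window θ.γ) ℓ.κ ℓ.moduli`** — J55's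
`coordLetter_box_truncRun_toClusterTower_of_gen` per torus (tables non-empty by `hΦsp` at `z = 0`; rate lowered) into dag-n22-w5's `ne9_EA_objectsOfRecord₁₃_of_outputCoordLetters` with
`Λt n i := ℓ₁(ω₁ + c)^{n−1−i}` and J55's `table_le_moduli_of_rows`.  LOCATED (hypothesis form); N22 NOT discharged. [folklore] -/
theorem ne9_EA_objectsOfRecord₁₃_of_genStepLipschitz (θ : Stage13Params F N) (ℓ : U3Letters₁₁) (hs : ℓ.Signs) (hγ : 0 < θ.γ) (hlim : PolLimitsExistOfRecord₁₃ F N θ)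
    (m' : ℕ) (M : ℕ) [NeZero M] (hM : M = F.L ^ m')
    (Gn : (K : ℕ) → GenTower (F.P K) 𝔸 M) (emb : ReadingMaps F (MatA N) 𝔸)
    (hloc : Localizes17OfRecord₁₃ F N θ (fun K => truncRun K (toClusterTower (Gn K))) emb)
    (sp : (K k : ℕ) → (domSys (F.P K) M (k + 1)).Dom → Set (CPair (F.P K) 𝔸))
    {κ κE δ₀ B₃ r ℓ₁ c ω₁ : ℝ} {lam : ℕ → ℕ → ℝ} {a : ℕ → ℕ → ℕ → ℝ}
    (hκ₀ : kappa₀ (4 * 2 ^ 4) (2 * 4) ≤ κ / 2) (hδ₀ : 0 < δ₀) (hB₃ : 0 ≤ B₃) (hr : 0 < r) (hκE : κ ≤ κE)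
    (Adm : (K k : ℕ) → OlderTerms (F.P K) 𝔸 M k → Prop)
    (hAdm : ∀ K, ∀ g ∈ Window θ.γ, ∀ k, Adm K k (olderOf (recTerm (Gn K) fun n => ((g n : ℝ) : ℂ)) k))
    (hG1 : ∀ (K k : ℕ), ∀ t ∈ Ioc (0 : ℝ) θ.γ, ∀ t' ∈ Ioc (0 : ℝ) θ.γ, ∀ (old old' : OlderTerms (F.P K) 𝔸 M k), Adm K k old → Adm K k old' → ∀ (D : ℕ → ℝ),
      (∀ (k' : ℕ) (hk' : k' < k) (Y : (domSys (F.P K) M (k' + 1)).Dom), ∀ φ' ∈ sp K k' Y,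
        ‖old ⟨k' + 1, Nat.succ_lt_succ hk'⟩ Y φ' - old' ⟨k' + 1, Nat.succ_lt_succ hk'⟩ Y φ'‖ ≤ Real.exp (-(κE * (domSys (F.P K) M (k' + 1)).dj Y)) * D (k' + 1)) →
      ∀ (X : (domSys (F.P K) M (k + 1)).Dom), ∀ φ ∈ sp K k X,
        ‖((Gn K) k).E ((t : ℝ) : ℂ) old φ X - ((Gn K) k).E ((t' : ℝ) : ℂ) old' φ X‖ ≤
          Real.exp (-(κE * (domSys (F.P K) M (k + 1)).dj X)) * (lam K k * |t - t'| + ∑ j ∈ range (k + 1), a K k j * D j))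
    (hlam : ∀ K k, lam K k ≤ ℓ₁) (hℓ₁ : 0 ≤ ℓ₁) (ha : ∀ K k j, j ≤ k → a K k j ≤ c * ω₁ ^ (k - j)) (hc : 0 ≤ c) (hω₁ : 0 ≤ ω₁)
    (Ec : ℕ → ℕ → Type*) [∀ K k, NormedAddCommGroup (Ec K k)] [∀ K k, NormedSpace ℂ (Ec K k)]
    (ι : letI := θ.instVβ₁; letI := θ.instVβ₂
      (K k : ℕ) → (domSys (F.P K) M (k + 1)).Dom → ((Fin (F.P K).d → Site (F.P K) (k + 1) → θ.Vβ) →L[ℝ] Ec K k))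
    (Φ : (K k : ℕ) → (domSys (F.P K) M (k + 1)).Dom → Ec K k → CPair (F.P K) 𝔸)
    (U : (K k : ℕ) → (domSys (F.P K) M (k + 1)).Dom → Set (Ec K k)) (hU : ∀ K k X, IsOpen (U K k X)) (hrU : ∀ K k X, ball (0 : Ec K k) r ⊆ U K k X)
    (hEhol : ∀ g ∈ Window θ.γ, ∀ (K k : ℕ) (X : (domSys (F.P K) M (k + 1)).Dom),
      DifferentiableOn ℂ (fun z => (truncRun K (toClusterTower (Gn K)) k).E (histPrefix g k) (Φ K k X z) X) (U K k X))
    (hΦemb : letI := θ.instVβ₁; letI := θ.instVβ₂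
      ∀ (K k : ℕ) (X : (domSys (F.P K) M (k + 1)).Dom) (Bf : Fin (F.P K).d → Site (F.P K) (k + 1) → θ.Vβ),
        Φ K k X (ι K k X Bf) = emb K k (fun l t => NormedSpace.exp (θ.ρ8 (Bf l t))))
    (hΦsp : ∀ (K k : ℕ) (X : (domSys (F.P K) M (k + 1)).Dom), ∀ z ∈ ball (0 : Ec K k) r, Φ K k X z ∈ sp K k X)
    (w : (K k : ℕ) → (domSys (F.P K) M (k + 1)).Dom → Site (F.P K) (k + 1) → ℝ) (hw₀ : ∀ K k X t, 0 ≤ w K k X t)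
    (hw : letI := θ.instVβ₁; letI := θ.instVβ₂; letI := θ.instιβ
      ∀ (K k : ℕ) (X : (domSys (F.P K) M (k + 1)).Dom) (l : Fin (F.P K).d) (t : Site (F.P K) (k + 1)) (c : θ.ιβ),
        ‖ι K k X (Pi.single l (Pi.single t (θ.bV c)))‖ ≤ w K k X t)
    (htail : ∀ (K k : ℕ) (X : (domSys (F.P K) M (k + 1)).Dom) (t : Site (F.P K) (k + 1)),
      let e : Site (F.P K) (k + 1) → TPt 4 (domCount (F.P K) M (k + 1) * M) := fun x i => (ZMod.cast (x i) : ZMod (domCount (F.P K) M (k + 1) * M))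
      w K k X t ≤ B₃ * Real.exp (-δ₀ * distCT (domCount (F.P K) M (k + 1)) M (e t) (nearT (M := M) (e t) X)))
    (hμω : ω₁ + c ≤ ℓ.ω) (hℓκ : ℓ.κ ≤ delta1 δ₀ κ ((M : ℝ) * 4))
    (hrow : 16 * B₃ ^ 2 / r ^ 2 * Real.exp (delta1 δ₀ κ ((M : ℝ) * 4) * ((M : ℝ) * 4) * 3) * K₀ (4 * 2 ^ 4) (2 * 4) * K₁ 4 (δ₀ / 2) * ℓ₁ ≤ ℓ.C₉ * ℓ.ω) :
    NE9 ((objectsOfRecord₁₃ F N θ ℓ).EA 0) (Window θ.γ) ℓ.κ ℓ.moduli := by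
  have hμ0 : 0 ≤ ω₁ + c := add_nonneg hω₁ hc
  -- J55 §1 per torus: ROAD 1's per-coordinate letters for the run towers at rate `κE`, lowered to `κ`
  have hsp : ∀ (K k : ℕ) (X : (domSys (F.P K) M (k + 1)).Dom), (sp K k X).Nonempty := fun K k X => ⟨Φ K k X 0, hΦsp K k X 0 (mem_ball_self hr)⟩
  have hlet : ∀ (K k : ℕ), ∀ g ∈ box θ.γ k, ∀ (i : Fin (k + 1)), ∀ t ∈ Ioc (0 : ℝ) θ.γ, ∀ (X : (domSys (F.P K) M (k + 1)).Dom), ∀ φ ∈ sp K k X,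
      ‖(truncRun K (toClusterTower (Gn K)) k).E g φ X - (truncRun K (toClusterTower (Gn K)) k).E (Function.update g i t) φ X‖ ≤
        (fun n i : ℕ => ℓ₁ * (ω₁ + c) ^ (n - 1 - i)) (k + 1) i * Real.exp (-(κ * (domSys (F.P K) M (k + 1)).dj X)) * |g i - t| := by
    intro K k g hg i t ht X φ hφ
    have h := coordLetter_box_truncRun_toClusterTower_of_gen (sp K) (Gn K) (Adm K) (hsp K) hγ (hAdm K) (hG1 K) (hlam K) hℓ₁ (ha K) hc hω₁ K k g hg i t ht X φ hφ
    have hd : 0 ≤ (domSys (F.P K) M (k + 1)).dj X := (domSys (F.P K) M (k + 1)).dj_nonneg X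
    have hexp : Real.exp (-(κE * (domSys (F.P K) M (k + 1)).dj X)) ≤ Real.exp (-(κ * (domSys (F.P K) M (k + 1)).dj X)) :=
      Real.exp_le_exp.mpr (by nlinarith)
    have hℓμ : 0 ≤ ℓ₁ * (ω₁ + c) ^ (k - (i : ℕ)) := by positivity
    show _ ≤ ℓ₁ * (ω₁ + c) ^ (k + 1 - 1 - (i : ℕ)) * Real.exp (-(κ * (domSys (F.P K) M (k + 1)).dj X)) * |g i - t|
    rw [Nat.add_sub_cancel]
    exact h.trans (mul_le_mul_of_nonneg_right (mul_le_mul_of_nonneg_left hexp hℓμ) (abs_nonneg _))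
  exact ne9_EA_objectsOfRecord₁₃_of_outputCoordLetters F N θ ℓ hs hlim m' M hM (fun K => truncRun K (toClusterTower (Gn K))) emb hloc sp
    (fun n i => ℓ₁ * (ω₁ + c) ^ (n - 1 - i)) (fun n i => by positivity) hκ₀ hδ₀ hB₃ hr hlet Ec ι Φ U hU hrU hEhol hΦemb hΦsp w hw₀ hw htail hℓκ
    (table_le_moduli_of_rows ℓ hs hμ0 hμω hrow)

/-! ## §2 ★★★ The kernel-face socket on ROAD 1, generator currency -/

open Classical Finset in
/-- ★★★ **THE KERNEL-FACE SOCKET ON ROAD 1, GENERATOR CURRENCY** — §1's inputs ⟹ **`N22At (u3OfRecord₁₃ θ (objectsOfRecord₁₃ F N θ ℓ) k)` for EVERY run length `k`** (dag-n27-c's `h22` row),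
by dag-n22-w3's level-free `n22At_u3OfRecord₁₃_objectsOfRecord₁₃_iff`.  LOCATED (hypothesis form); N22 NOT discharged. [folklore] -/
theorem n22At_u3OfRecord₁₃_of_genStepLipschitz (θ : Stage13Params F N) (ℓ : U3Letters₁₁) (hs : ℓ.Signs) (hγ : 0 < θ.γ) (hlim : PolLimitsExistOfRecord₁₃ F N θ)
    (m' : ℕ) (M : ℕ) [NeZero M] (hM : M = F.L ^ m')
    (Gn : (K : ℕ) → GenTower (F.P K) 𝔸 M) (emb : ReadingMaps F (MatA N) 𝔸)
    (hloc : Localizes17OfRecord₁₃ F N θ (fun K => truncRun K (toClusterTower (Gn K))) emb)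
    (sp : (K k : ℕ) → (domSys (F.P K) M (k + 1)).Dom → Set (CPair (F.P K) 𝔸))
    {κ κE δ₀ B₃ r ℓ₁ c ω₁ : ℝ} {lam : ℕ → ℕ → ℝ} {a : ℕ → ℕ → ℕ → ℝ}
    (hκ₀ : kappa₀ (4 * 2 ^ 4) (2 * 4) ≤ κ / 2) (hδ₀ : 0 < δ₀) (hB₃ : 0 ≤ B₃) (hr : 0 < r) (hκE : κ ≤ κE)
    (Adm : (K k : ℕ) → OlderTerms (F.P K) 𝔸 M k → Prop)
    (hAdm : ∀ K, ∀ g ∈ Window θ.γ, ∀ k, Adm K k (olderOf (recTerm (Gn K) fun n => ((g n : ℝ) : ℂ)) k))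
    (hG1 : ∀ (K k : ℕ), ∀ t ∈ Ioc (0 : ℝ) θ.γ, ∀ t' ∈ Ioc (0 : ℝ) θ.γ, ∀ (old old' : OlderTerms (F.P K) 𝔸 M k), Adm K k old → Adm K k old' → ∀ (D : ℕ → ℝ),
      (∀ (k' : ℕ) (hk' : k' < k) (Y : (domSys (F.P K) M (k' + 1)).Dom), ∀ φ' ∈ sp K k' Y,
        ‖old ⟨k' + 1, Nat.succ_lt_succ hk'⟩ Y φ' - old' ⟨k' + 1, Nat.succ_lt_succ hk'⟩ Y φ'‖ ≤ Real.exp (-(κE * (domSys (F.P K) M (k' + 1)).dj Y)) * D (k' + 1)) →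
      ∀ (X : (domSys (F.P K) M (k + 1)).Dom), ∀ φ ∈ sp K k X,
        ‖((Gn K) k).E ((t : ℝ) : ℂ) old φ X - ((Gn K) k).E ((t' : ℝ) : ℂ) old' φ X‖ ≤
          Real.exp (-(κE * (domSys (F.P K) M (k + 1)).dj X)) * (lam K k * |t - t'| + ∑ j ∈ range (k + 1), a K k j * D j))
    (hlam : ∀ K k, lam K k ≤ ℓ₁) (hℓ₁ : 0 ≤ ℓ₁) (ha : ∀ K k j, j ≤ k → a K k j ≤ c * ω₁ ^ (k - j)) (hc : 0 ≤ c) (hω₁ : 0 ≤ ω₁)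
    (Ec : ℕ → ℕ → Type*) [∀ K k, NormedAddCommGroup (Ec K k)] [∀ K k, NormedSpace ℂ (Ec K k)]
    (ι : letI := θ.instVβ₁; letI := θ.instVβ₂
      (K k : ℕ) → (domSys (F.P K) M (k + 1)).Dom → ((Fin (F.P K).d → Site (F.P K) (k + 1) → θ.Vβ) →L[ℝ] Ec K k))
    (Φ : (K k : ℕ) → (domSys (F.P K) M (k + 1)).Dom → Ec K k → CPair (F.P K) 𝔸)
    (U : (K k : ℕ) → (domSys (F.P K) M (k + 1)).Dom → Set (Ec K k)) (hU : ∀ K k X, IsOpen (U K k X)) (hrU : ∀ K k X, ball (0 : Ec K k) r ⊆ U K k X)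
    (hEhol : ∀ g ∈ Window θ.γ, ∀ (K k : ℕ) (X : (domSys (F.P K) M (k + 1)).Dom),
      DifferentiableOn ℂ (fun z => (truncRun K (toClusterTower (Gn K)) k).E (histPrefix g k) (Φ K k X z) X) (U K k X))
    (hΦemb : letI := θ.instVβ₁; letI := θ.instVβ₂
      ∀ (K k : ℕ) (X : (domSys (F.P K) M (k + 1)).Dom) (Bf : Fin (F.P K).d → Site (F.P K) (k + 1) → θ.Vβ),
        Φ K k X (ι K k X Bf) = emb K k (fun l t => NormedSpace.exp (θ.ρ8 (Bf l t))))
    (hΦsp : ∀ (K k : ℕ) (X : (domSys (F.P K) M (k + 1)).Dom), ∀ z ∈ ball (0 : Ec K k) r, Φ K k X z ∈ sp K k X)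
    (w : (K k : ℕ) → (domSys (F.P K) M (k + 1)).Dom → Site (F.P K) (k + 1) → ℝ) (hw₀ : ∀ K k X t, 0 ≤ w K k X t)
    (hw : letI := θ.instVβ₁; letI := θ.instVβ₂; letI := θ.instιβ
      ∀ (K k : ℕ) (X : (domSys (F.P K) M (k + 1)).Dom) (l : Fin (F.P K).d) (t : Site (F.P K) (k + 1)) (c : θ.ιβ),
        ‖ι K k X (Pi.single l (Pi.single t (θ.bV c)))‖ ≤ w K k X t)
    (htail : ∀ (K k : ℕ) (X : (domSys (F.P K) M (k + 1)).Dom) (t : Site (F.P K) (k + 1)),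
      let e : Site (F.P K) (k + 1) → TPt 4 (domCount (F.P K) M (k + 1) * M) := fun x i => (ZMod.cast (x i) : ZMod (domCount (F.P K) M (k + 1) * M))
      w K k X t ≤ B₃ * Real.exp (-δ₀ * distCT (domCount (F.P K) M (k + 1)) M (e t) (nearT (M := M) (e t) X)))
    (hμω : ω₁ + c ≤ ℓ.ω) (hℓκ : ℓ.κ ≤ delta1 δ₀ κ ((M : ℝ) * 4))
    (hrow : 16 * B₃ ^ 2 / r ^ 2 * Real.exp (delta1 δ₀ κ ((M : ℝ) * 4) * ((M : ℝ) * 4) * 3) * K₀ (4 * 2 ^ 4) (2 * 4) * K₁ 4 (δ₀ / 2) * ℓ₁ ≤ ℓ.C₉ * ℓ.ω) (k : ℕ) :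
    N22At (u3OfRecord₁₃ θ (objectsOfRecord₁₃ F N θ ℓ) k) :=
  (n22At_u3OfRecord₁₃_objectsOfRecord₁₃_iff F N θ ℓ hs k).2
    (ne9_EA_objectsOfRecord₁₃_of_genStepLipschitz F N θ ℓ hs hγ hlim m' M hM Gn emb hloc sp hκ₀ hδ₀ hB₃ hr hκE Adm hAdm hG1 hlam hℓ₁ ha hc hω₁ Ec ι Φ U hU hrU hEhol hΦemb hΦsp
      w hw₀ hw htail hμω hℓκ hrow)

/-! ## §3 ★★★ The N22 pin face on ROAD 1, generator currency -/

open Classical Finset in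
/-- ★★★ **THE N22 PIN FACE ON ROAD 1, GENERATOR CURRENCY**: under K3's node-U3 pin at the tuple (`hpin`), §1's inputs at `θ.toStage13Params` give `N22At (rateCarriersOfRecord₁₃CoPH 𝔯 F θ hP g₀ os k).u3`
for EVERY run length `k` — dag-n22-w3's pin form.  THE N22 ROW SENTENCE on ROAD 1, generator currency: «ONE Lipschitz property of def-W1's one-step map {last coupling, older terms} ↦ new
term per step and torus, whose linear channel contracts (`ω₁ + c ≤ ω`), the generated runs admissible, + the readings, the law and (1.21) ⇒ §2b `h9` ∕ `N22At` — nothing from node N18».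
LOCATED (hypothesis form); N22 NOT discharged. [folklore] -/
theorem n22At_rateCarriers_of_kernels_pin_of_genStepLipschitz (𝔯 : RateReading₁₃CoPH N) (θ : Stage13HParams F N) (hP : θ.Provisos₁₃CoPH F N)
    (g₀ : ℕ → ℝ) (os : List (ULoop F)) (ℓ : U3Letters₁₁) (hs : ℓ.Signs) (hγ : 0 < θ.γ)
    (hpin : (𝔯.lit F θ hP g₀ os).u3 = objectsOfRecord₁₃ F N θ.toStage13Params ℓ) (hlim : PolLimitsExistOfRecord₁₃ F N θ.toStage13Params)
    (m' : ℕ) (M : ℕ) [NeZero M] (hM : M = F.L ^ m')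
    (Gn : (K : ℕ) → GenTower (F.P K) 𝔸 M) (emb : ReadingMaps F (MatA N) 𝔸)
    (hloc : Localizes17OfRecord₁₃ F N θ.toStage13Params (fun K => truncRun K (toClusterTower (Gn K))) emb)
    (sp : (K k : ℕ) → (domSys (F.P K) M (k + 1)).Dom → Set (CPair (F.P K) 𝔸))
    {κ κE δ₀ B₃ r ℓ₁ c ω₁ : ℝ} {lam : ℕ → ℕ → ℝ} {a : ℕ → ℕ → ℕ → ℝ}
    (hκ₀ : kappa₀ (4 * 2 ^ 4) (2 * 4) ≤ κ / 2) (hδ₀ : 0 < δ₀) (hB₃ : 0 ≤ B₃) (hr : 0 < r) (hκE : κ ≤ κE)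
    (Adm : (K k : ℕ) → OlderTerms (F.P K) 𝔸 M k → Prop)
    (hAdm : ∀ K, ∀ g ∈ Window θ.γ, ∀ k, Adm K k (olderOf (recTerm (Gn K) fun n => ((g n : ℝ) : ℂ)) k))
    (hG1 : ∀ (K k : ℕ), ∀ t ∈ Ioc (0 : ℝ) θ.γ, ∀ t' ∈ Ioc (0 : ℝ) θ.γ, ∀ (old old' : OlderTerms (F.P K) 𝔸 M k), Adm K k old → Adm K k old' → ∀ (D : ℕ → ℝ),
      (∀ (k' : ℕ) (hk' : k' < k) (Y : (domSys (F.P K) M (k' + 1)).Dom), ∀ φ' ∈ sp K k' Y,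
        ‖old ⟨k' + 1, Nat.succ_lt_succ hk'⟩ Y φ' - old' ⟨k' + 1, Nat.succ_lt_succ hk'⟩ Y φ'‖ ≤ Real.exp (-(κE * (domSys (F.P K) M (k' + 1)).dj Y)) * D (k' + 1)) →
      ∀ (X : (domSys (F.P K) M (k + 1)).Dom), ∀ φ ∈ sp K k X,
        ‖((Gn K) k).E ((t : ℝ) : ℂ) old φ X - ((Gn K) k).E ((t' : ℝ) : ℂ) old' φ X‖ ≤
          Real.exp (-(κE * (domSys (F.P K) M (k + 1)).dj X)) * (lam K k * |t - t'| + ∑ j ∈ range (k + 1), a K k j * D j))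
    (hlam : ∀ K k, lam K k ≤ ℓ₁) (hℓ₁ : 0 ≤ ℓ₁) (ha : ∀ K k j, j ≤ k → a K k j ≤ c * ω₁ ^ (k - j)) (hc : 0 ≤ c) (hω₁ : 0 ≤ ω₁)
    (Ec : ℕ → ℕ → Type*) [∀ K k, NormedAddCommGroup (Ec K k)] [∀ K k, NormedSpace ℂ (Ec K k)]
    (ι : letI := θ.instVβ₁; letI := θ.instVβ₂
      (K k : ℕ) → (domSys (F.P K) M (k + 1)).Dom → ((Fin (F.P K).d → Site (F.P K) (k + 1) → θ.Vβ) →L[ℝ] Ec K k))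
    (Φ : (K k : ℕ) → (domSys (F.P K) M (k + 1)).Dom → Ec K k → CPair (F.P K) 𝔸)
    (U : (K k : ℕ) → (domSys (F.P K) M (k + 1)).Dom → Set (Ec K k)) (hU : ∀ K k X, IsOpen (U K k X)) (hrU : ∀ K k X, ball (0 : Ec K k) r ⊆ U K k X)
    (hEhol : ∀ g ∈ Window θ.γ, ∀ (K k : ℕ) (X : (domSys (F.P K) M (k + 1)).Dom),
      DifferentiableOn ℂ (fun z => (truncRun K (toClusterTower (Gn K)) k).E (histPrefix g k) (Φ K k X z) X) (U K k X))
    (hΦemb : letI := θ.instVβ₁; letI := θ.instVβ₂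
      ∀ (K k : ℕ) (X : (domSys (F.P K) M (k + 1)).Dom) (Bf : Fin (F.P K).d → Site (F.P K) (k + 1) → θ.Vβ),
        Φ K k X (ι K k X Bf) = emb K k (fun l t => NormedSpace.exp (θ.ρ8 (Bf l t))))
    (hΦsp : ∀ (K k : ℕ) (X : (domSys (F.P K) M (k + 1)).Dom), ∀ z ∈ ball (0 : Ec K k) r, Φ K k X z ∈ sp K k X)
    (w : (K k : ℕ) → (domSys (F.P K) M (k + 1)).Dom → Site (F.P K) (k + 1) → ℝ) (hw₀ : ∀ K k X t, 0 ≤ w K k X t)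
    (hw : letI := θ.instVβ₁; letI := θ.instVβ₂; letI := θ.instιβ
      ∀ (K k : ℕ) (X : (domSys (F.P K) M (k + 1)).Dom) (l : Fin (F.P K).d) (t : Site (F.P K) (k + 1)) (c : θ.ιβ),
        ‖ι K k X (Pi.single l (Pi.single t (θ.bV c)))‖ ≤ w K k X t)
    (htail : ∀ (K k : ℕ) (X : (domSys (F.P K) M (k + 1)).Dom) (t : Site (F.P K) (k + 1)),
      let e : Site (F.P K) (k + 1) → TPt 4 (domCount (F.P K) M (k + 1) * M) := fun x i => (ZMod.cast (x i) : ZMod (domCount (F.P K) M (k + 1) * M))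
      w K k X t ≤ B₃ * Real.exp (-δ₀ * distCT (domCount (F.P K) M (k + 1)) M (e t) (nearT (M := M) (e t) X)))
    (hμω : ω₁ + c ≤ ℓ.ω) (hℓκ : ℓ.κ ≤ delta1 δ₀ κ ((M : ℝ) * 4))
    (hrow : 16 * B₃ ^ 2 / r ^ 2 * Real.exp (delta1 δ₀ κ ((M : ℝ) * 4) * ((M : ℝ) * 4) * 3) * K₀ (4 * 2 ^ 4) (2 * 4) * K₁ 4 (δ₀ / 2) * ℓ₁ ≤ ℓ.C₉ * ℓ.ω) (k : ℕ) :
    N22At (rateCarriersOfRecord₁₃CoPH 𝔯 F θ hP g₀ os k).u3 :=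
  n22At_rateCarriers_of_kernels_pin_of_ne9 𝔯 θ hP g₀ os ℓ hs hpin
    (ne9_EA_objectsOfRecord₁₃_of_genStepLipschitz F N θ.toStage13Params ℓ hs hγ hlim m' M hM Gn emb hloc sp hκ₀ hδ₀ hB₃ hr hκE Adm hAdm hG1 hlam hℓ₁ ha hc hω₁ Ec ι Φ U hU hrU hEhol hΦemb hΦsp
      w hw₀ hw htail hμω hℓκ hrow) k

/-! ## §4 ROAD 1's rows are jointly satisfiable with `ℓ.Signs` (A5 rider; J48 §5's analogue) -/

/-- ★ **NON-VACUITY OF ROAD 1's ROWS.**  For every first-order growth `μ = ω₁ + c ∈ [0, 1[`, table constant `C ≥ 0`, `ℓ₁ ≥ 0` and decay `δ₁ ≥ 0` there IS a letter block `ℓ` with `ℓ.Signs`,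
`ℓ.κ = δ₁` and the rows of J55 §2 ∕ §1 above: `μ ≤ ℓ.ω`, `ℓ.κ ≤ δ₁`, `C·ℓ₁ ≤ ℓ.C₉·ℓ.ω` — take `ω = ρ = θ₅ := (1 + μ)∕2`, `C₉ := Cℓ₁∕ω`, `C₅ = cr := 0`.  The condition `μ < 1` is also
NECESSARY (`ℓ.ω < 1`): the END OF RECORD's clause N2 exactly. [folklore] -/
theorem exists_letterBlock_rows_road1 {μ C ℓ₁ δ₁ : ℝ} (hμ0 : 0 ≤ μ) (hμ1 : μ < 1) (hC : 0 ≤ C) (hℓ₁ : 0 ≤ ℓ₁) (hδ₁ : 0 ≤ δ₁) :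
    ∃ ℓ : U3Letters₁₁, ℓ.Signs ∧ ℓ.κ = δ₁ ∧ μ ≤ ℓ.ω ∧ ℓ.κ ≤ δ₁ ∧ C * ℓ₁ ≤ ℓ.C₉ * ℓ.ω := by
  set ω : ℝ := (1 + μ) / 2 with hω
  have hω0 : 0 < ω := by rw [hω]; linarith
  have hω1 : ω < 1 := by rw [hω]; linarith
  have hμω : μ ≤ ω := by rw [hω]; linarith
  have hC₉ : 0 ≤ C * ℓ₁ / ω := by positivity
  refine ⟨⟨δ₁, ω, 0, C * ℓ₁ / ω, ω, 0, ω⟩, ?_, rfl, hμω, le_rfl, le_of_eq ?_⟩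
  · exact { κ_nonneg := hδ₁, θ₅_pos := hω0, θ₅_lt_one := hω1, C₅_nonneg := le_rfl, C₉_nonneg := hC₉, ω_nonneg := hω0.le, ω_lt_one := hω1,
            cr_nonneg := le_rfl, θ₅_le_ρ := le_rfl, ω_le_ρ := le_rfl, ρ_lt_one := hω1 }
  · show C * ℓ₁ = C * ℓ₁ / ω * ω
    rw [div_mul_cancel₀ _ hω0.ne']

end YMDAG.N22.KernelFading

end
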